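import Summits.AnomalousDissipation.AnomalousDissipation.Theorems.SolenoidalFractalHomogenisationLagrangianStepVmodLeakEnergy
import Summits.AnomalousDissipation.AnomalousDissipation.Theorems.SolenoidalFractalHomogenisationLagrangianStepOneLevelSplitDefsH
import Summits.AnomalousDissipation.AnomalousDissipation.Theorems.SolenoidalFractalHomogenisationLagrangianStepPairData
import Literature.Analysis.FunctionSpaces.TorusWeightedGalerkinCoefficients
import HarnessLib

/-!
# K1L_D (stmt-AnomalousDissipation-27980): (V_mod) flat stage, block (ss) — HIGH LABELS: the W7 clause `HighLabelDecayW` read at the propagator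
# level on a single real mode pair (rows «H / high / τ ≥ P» of the certifier's table; tool T-H)
(helper; `--supports 27980 --as helper`; prover ad-sawtooth-k1loc-p1 g15; on top of `…VmodLeakEnergy` (`exists_sol_modeRep_energy`: bridge + energy).)

`HighLabelDecayW W M hM lo hi Λ β νh Kb CK cK` (registry v4, `…OneLevelSplitDefsH`) gives, for data without Bloch labels of norm `< L` with
`n·ν ≤ Kb·L`, the ν-uniform decay `∫‖u t‖² ≤ CK·exp(−2cKνt)·∫‖F‖²` of every weak cell solution (a.e. `t`).  A weakly divergence-free pair datum
`v ∈ V2` at a label `ℓ` with `L ≤ ‖ℓ‖`, `2‖ℓ‖ ≤ n` carries no label of norm `< L` (its modes `±ℓ + nℤ³` have label representatives `±ℓ`), its real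
trigonometric representative is an admissible `IsDatum`, and the orbit's energy at every time is below the energy representative (`…VmodLeakEnergy`).
Hence, for a window start `s` at carrier phase 0 and `ν < νh`:

  `‖U s t v‖ ≤ √CK · exp(−cK·ν·(t − s)) · ‖v‖`   (`norm_apply_le_of_highLabelDecay`),

and a fortiori `‖𝓕(U s t v)(ℓ)‖ ≤ √CK·exp(−cK·ν·(t−s))·‖v‖`.  `sorry`-free; NOT a proof of (ss), of the stub, of K1L_D or of AD; rung F-D1.A0.
-/

set_option linter.dupNamespace false

noncomputable section

namespace Summit.AnomalousDissipation.AnomalousDissipation.Theorems.SolenoidalFractalHomogenisation.LagrangianStep.VmodGen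

open Set MeasureTheory Complex UnitAddTorus
open scoped InnerProductSpace ENNReal
open Literature.Analysis Literature.Analysis.FunctionSpaces Literature.Analysis.FunctionSpaces.Torus
open Literature.Analysis.FluidPDE Literature.Analysis.FluidPDE.Torus Literature.Analysis.FluidPDE.LatticeShear
open Summit.AnomalousDissipation.AnomalousDissipation.Theorems.SolenoidalFractalHomogenisation.LagrangianStep.CellChain
  (modeRep le_on_Icc_of_ae_le norm_latticeVec_ge_of_classPair_ne)
open Summit.AnomalousDissipation.AnomalousDissipation.Theorems.SolenoidalFractalHomogenisation.LagrangianStep.VmodFlat (fc)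

variable {k : ℕ}

set_option maxHeartbeats 1600000 in
/-- **W7 AT THE PROPAGATOR LEVEL ON A PAIR DATUM.**  See the module docstring: with `HighLabelDecayW W M hM lo hi Λ β νh Kb CK cK`, `ν < νh`,
`n·ν ≤ Kb·L`, a window start at carrier phase 0 and a weakly divergence-free pair datum `v` at a label `ℓ` with `L ≤ ‖ℓ‖`, `2‖ℓ‖ ≤ n`:
`‖U s t v‖ ≤ √CK·exp(−cK·ν·(t−s))·‖v‖`. [cite: BedrossianCotiZelati2017, Thm 1.1] [cite: Temam1984, Ch. III §1 Lemma 1.2] -/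
theorem norm_apply_le_of_highLabelDecay (W : LatticeWord k) (M : ℝ) (hM : 0 < M) {lo hi Λ β νh Kb CK cK : ℝ}
    (hH : HighLabelDecayW W M hM lo hi Λ β νh Kb CK cK) (hlo : 0 < lo) (hhi : 0 ≤ hi) (hΛ : 1 ≤ Λ) (hCK : 0 ≤ CK)
    {ν : ℝ} (hν : ν ∈ Set.Ioo 0 νh) {n : ℕ} (hn : 1 ≤ n) {𝔸 : Visc4 (Fin 3)} (hodd : OddSmall 𝔸 (ν * β))
    (hwin : ∃ lam ∈ Set.Icc (1:ℝ) Λ, NearIso 𝔸 (ν * (lo / lam)) (ν * (hi * lam)))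
    {Tw : ℝ} {U : ℝ → ℝ → (V2 →L[ℝ] V2)} (hU : IsPropagator Tw (cellField W M hM ν hν.1 n) ((1 / (n:ℝ) ^ 2) • 𝔸) U)
    {s t : ℝ} (hs : 0 ≤ s) (hst : s ≤ t) (htT : t ≤ Tw) (hsT : s < Tw)
    (hphase : ∀ τ, cellField W M hM ν hν.1 n (s + τ) = cellField W M hM ν hν.1 n τ)
    {L : ℝ} (hL : 0 < L) (hKL : (n : ℝ) * ν ≤ Kb * L)
    {ℓ : Fin 3 → ℤ} (hℓ0 : ℓ ≠ 0) (hℓL : L ≤ ‖Torus.latticeVec ℓ‖) (hℓn : 2 * ‖Torus.latticeVec ℓ‖ ≤ n)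
    (v : V2) (hv : v ∈ divFreeL2 (Fin 3)) (hvs : ∀ k', k' ≠ ℓ → k' ≠ -ℓ → fc v k' = 0) :
    ‖U s t v‖ ≤ Real.sqrt CK * Real.exp (-(cK * ν * (t - s))) * ‖v‖ := by
  classical
  have hnpos : 0 < n := hn
  have hn0 : (0:ℝ) < n := by exact_mod_cast hnpos
  have hn2 : (0:ℝ) < 1 / (n:ℝ) ^ 2 := by positivity
  have hL0 : 0 < Tw - s := by linarith
  -- lam-free window of the cell tensor
  have hAΛ : NearIso 𝔸 (ν * (lo / Λ)) (ν * (hi * Λ)) := by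
    obtain ⟨lam, hlam, hA⟩ := hwin
    have hlam1 : 0 < lam := lt_of_lt_of_le one_pos hlam.1
    exact hA.mono (mul_le_mul_of_nonneg_left (div_le_div_of_nonneg_left hlo.le hlam1 hlam.2) hν.1.le)
      (mul_le_mul_of_nonneg_left (mul_le_mul_of_nonneg_left hlam.2 hhi) hν.1.le)
  have hN : NearIso ((1 / (n:ℝ) ^ 2) • 𝔸) ((1 / (n:ℝ) ^ 2) * (ν * (lo / Λ))) ((1 / (n:ℝ) ^ 2) * (ν * (hi * Λ))) := hAΛ.smul hn2.le
  have hloU : 0 < (1 / (n:ℝ) ^ 2) * (ν * (lo / Λ)) := by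
    have hΛ0 : 0 < Λ := lt_of_lt_of_le one_pos hΛ
    have hν0 : 0 < ν := hν.1
    positivity
  -- the bridge with energy, along the stretched word's cell field
  set W₁ : LatticeWord k := (W.stretch M hM).stretch (1 / ν) (one_div_pos.mpr hν.1) with hW₁
  have hU' : IsPropagator Tw (W₁.cell n) ((1 / (n:ℝ) ^ 2) • 𝔸) U := hU
  have hphase' : ∀ τ, W₁.cell n (s + τ) = W₁.cell n τ := hphase
  have hvdiv : FunctionSpaces.Torus.IsWeaklyDivFree (v : VF) := (mem_divFreeL2_iff v).1 hv
  obtain ⟨u, E, Q, hu, -, hE0, hEc, -, -, hEae, -, -, hUE⟩ := exists_sol_modeRep_energy W₁ n hN hloU hU' hs hsT hphase' v hvdiv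
  -- the real trigonometric representative of the datum is admissible for the clause
  have hvs' : ∀ k', k' ≠ ℓ → k' ≠ -ℓ → mFourierCoeff (FunctionSpaces.EuclideanSpace.complexify ∘ ⇑v) k' = 0 := hvs
  set F : VF := FunctionSpaces.Torus.realTrigPoly {ℓ} (fun _ => (2:ℂ) • mFourierCoeff (FunctionSpaces.EuclideanSpace.complexify ∘ ⇑v) ℓ) with hF
  have hF2 : MemLp F 2 volume := FunctionSpaces.Torus.memLp_realTrigPoly {ℓ} _ 2
  have hFi : Integrable F volume := hF2.integrable one_le_two
  have hvF : v = hF2.toLp F := PropagatorSymm.eq_toLp_realTrigPoly_of_pair hℓ0 v hvs'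
  have hFv : (F : VF) =ᵐ[volume] ⇑v := by rw [hvF]; exact (MemLp.coeFn_toLp hF2).symm
  have hFdiv : FunctionSpaces.Torus.IsWeaklyDivFree F := hvdiv.congr_ae hFv.symm
  have hcoef : ∀ k', mFourierCoeff (FunctionSpaces.EuclideanSpace.complexify ∘ F) k' = fc v k' := fun k' =>
    FunctionSpaces.Torus.mFourierCoeff_congr_ae (hFv.fun_comp FunctionSpaces.EuclideanSpace.complexify) k'
  have hne : ℓ ≠ -ℓ := fun h' => hℓ0 (by
    funext i; have hi := congrFun h' i; simp only [Pi.neg_apply] at hi; have : ℓ i = 0 := by omega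
    simpa using this)
  have h0ℓ : (0 : Fin 3 → ℤ) ≠ ℓ := fun h => hℓ0 h.symm
  have h0ℓ' : (0 : Fin 3 → ℤ) ≠ -ℓ := fun h => hℓ0 (by rw [← neg_neg ℓ, ← h, neg_zero])
  have hdatum : IsDatum F := by
    refine ⟨(FunctionSpaces.Torus.isSmooth_realTrigPoly _ _).memSobolev_one_complexify, ?_, hFdiv⟩
    refine hasZeroMean_of_mFourierCoeff_zero ?_
    rw [hcoef]; exact hvs 0 h0ℓ h0ℓ'
  -- the datum carries no Bloch label of norm `< L`
  have hlab : ∀ k' : Fin 3 → ℤ, (∃ ℓ' z : Fin 3 → ℤ, ‖Torus.latticeVec ℓ'‖ < L ∧ k' = ℓ' + (n : ℤ) • z) → ∀ i, modeCoeff k' F i = 0 := by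
    intro k' hk' i
    rw [modeCoeff_eq hFi, hcoef]
    obtain ⟨ℓ', z, hℓ'L, hk'eq⟩ := hk'
    suffices h : fc v k' = 0 by rw [h]; rfl
    by_cases h1 : k' = ℓ
    · exfalso
      -- `ℓ = ℓ' + n•z`: `ℓ'` is in the class of `ℓ`
      have hcl : (∃ z' : Fin 3 → ℤ, ℓ' = ℓ + (n : ℤ) • z') ∨ (∃ z' : Fin 3 → ℤ, ℓ' = -ℓ + (n : ℤ) • z') :=
        Or.inl ⟨-z, by rw [h1] at hk'eq; rw [hk'eq]; simp⟩
      by_cases h2 : ℓ' = ℓ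
      · rw [h2] at hℓ'L; linarith
      · by_cases h3 : ℓ' = -ℓ
        · rw [h3, Torus.latticeVec_neg, norm_neg] at hℓ'L; linarith
        · have hge := norm_latticeVec_ge_of_classPair_ne hcl h2 h3
          linarith
    · by_cases h1' : k' = -ℓ
      · exfalso
        have hcl : (∃ z' : Fin 3 → ℤ, ℓ' = ℓ + (n : ℤ) • z') ∨ (∃ z' : Fin 3 → ℤ, ℓ' = -ℓ + (n : ℤ) • z') :=
          Or.inr ⟨-z, by rw [h1'] at hk'eq; rw [hk'eq]; simp⟩
        by_cases h2 : ℓ' = ℓ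
        · rw [h2] at hℓ'L; linarith
        · by_cases h3 : ℓ' = -ℓ
          · rw [h3, Torus.latticeVec_neg, norm_neg] at hℓ'L; linarith
          · have hge := norm_latticeVec_ge_of_classPair_ne hcl h2 h3
            linarith
      · exact hvs k' h1 h1'
  -- the clause along the cell field (the Lions solution from `⇑v` is a solution from `F`)
  have hu' : IsWeakTensorPassiveVectorOn 0 (Tw - s) ((1 / (n:ℝ) ^ 2) • 𝔸) (cellField W M hM ν hν.1 n) F u := hu.congr_datum hFv
  have hdecay := hH ν hν n hn 𝔸 hodd hwin L hL hKL F hdatum hlab (Tw - s) hL0 u hu'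
  -- `∫‖F‖² = ‖v‖²`
  have hFnorm : ∫ x, ‖F x‖ ^ 2 = ‖v‖ ^ 2 := by
    rw [OneLevelSplit.norm_sq_eq_integral]
    exact integral_congr_ae (hFv.mono fun x hx => by simp only [hx])
  -- the energy representative obeys the decay at EVERY time
  set G : ℝ → ℝ := fun τ => CK * Real.exp (-(2 * cK * ν * τ)) * ‖v‖ ^ 2 with hG
  have hae : ∀ᵐ τ ∂(volume.restrict (Ioo 0 (Tw - s))), E τ ≤ G τ := by
    filter_upwards [hdecay, hEae] with τ hτ hEτ
    rw [hEτ, hG]; dsimp only; rw [← hFnorm]; exact hτ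
  have hGc : ContinuousOn G (Icc 0 (Tw - s)) :=
    ((continuous_const.mul (Real.continuous_exp.comp (continuous_const.mul continuous_id).neg)).mul continuous_const).continuousOn
  have hall := le_on_Icc_of_ae_le hL0 hEc hGc hae
  have hτ : t - s ∈ Icc 0 (Tw - s) := ⟨by linarith, by linarith⟩
  have est : s + (t - s) = t := by ring
  have h1 : ‖U s t v‖ ^ 2 ≤ G (t - s) := by
    have h := hUE (t - s) hτ
    rw [est] at h
    exact h.trans (hall (t - s) hτ)
  have h2 : G (t - s) = (Real.sqrt CK * Real.exp (-(cK * ν * (t - s))) * ‖v‖) ^ 2 := by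
    rw [hG]; dsimp only
    rw [mul_pow, mul_pow, Real.sq_sqrt hCK, ← Real.exp_nat_mul]
    congr 2; push_cast; ring
  rw [h2] at h1
  exact (pow_le_pow_iff_left₀ (norm_nonneg _) (by positivity) two_ne_zero).1 h1

end Summit.AnomalousDissipation.AnomalousDissipation.Theorems.SolenoidalFractalHomogenisation.LagrangianStep.VmodGen

end
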